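import Summits.Ventures.GridStability.Lyapunov.StructurePreservingRateRoa
import HarnessLib

/-!
# GridStability/Lyapunov/StructurePreservingRateDiam — «SP-RATE» with the DIAMETER constant: the leaf
# Poincaré bound by path Cauchy–Schwarz (`4d·ΣD/β` in place of `4n²·ΣD/β`, `d` = any bound on the
# coupling-graph distances) and the sharpened closed-form rate `vhRateD`

Cell `gridfusion` (LADDER-GRIDFUSION), seat gridfusion-lyap-1 (g7), brief «SP-RATE» — the lever named by
lead g8 (RULING 9p (2), memo §3 fold #39: «the leaf-Poincaré walk constant n² is the SP-rate ceiling»).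
`StructurePreservingRate.sum_D_sq_le_of_mem_constraintSet` (p544339) bounds `Σ Dᵢφᵢ²` on the momentum
leaf with the crude walk estimate `|φᵢ − φⱼ| ≤ n·max_e|Δσ_e|` (model-2's `abs_sub_le_card_mul`), which
costs `n²`. Here every pair of buses is joined by a PATH of length `≤ d` (hypothesis `hdiam`; `d` = the
diameter, or any bound of it — for a BFS tree of depth `e`, `d = 2e`), and Cauchy–Schwarz ALONG THE PATH
gives `(φᵢ − φⱼ)² ≤ ℓ·Σ_{e ∈ path}(Δσ_e)² ≤ (4ℓ/β)·Q` (the path's darts are distinct ordered pairs, so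
their `bΔσ²` sum is below the full double sum `4Q`): the constant becomes `4d·ΣD/β`.

WHAT IS PROVED (no named fact; two closed-form definitions `vhRateD`, `vhGainD`):
* `sub_eq_sum_darts` (telescoping along a walk), `sum_darts_le_sum_sum` (a dart-sum of a walk with
  distinct darts is below the ordered double sum), `sq_sub_le_length_mul_sum_darts` (Cauchy–Schwarz
  along the walk), `sq_sub_le_of_walk` (`(φᵤ − φᵥ)² ≤ 4ℓQ/β` along a walk of length `ℓ` with distinct
  darts on the coupling graph);
* **`sum_D_sq_le_of_diam`** — leaf Poincaré bound with the diameter constant: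
  `Σ Dᵢφᵢ² ≤ (4d·ΣD/β)·Q + (2Σ_gen M/ΣD)·K` on the momentum leaf;
* `vhRateD p β θ h d = min{h/(1 + hΣ_gen M/ΣD), 2h·g(θ)/(1 + 4h·d·ΣD/β)}`, `vhGainD` (max form),
  `vhRateD_pos`, `two_le_vhGainD`, **`fderiv_vh_le_neg_vhRateD_mul`** (`V̇_h ≤ −vhRateD·V_h` on the
  closed window ∩ leaf).
The gain comparison `V_h ≤ vhGainD·V` and the packaging along solutions are the sequel
`StructurePreservingRateDiamRoa.lean`. THREE COLUMNS: mathematics about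
MODEL MV-3 (any `n`, graph, damping); `vhRateD` is a certified LOWER bound on the model's rate; no
certificate data; no sentence here says a grid is stable or well damped. Standard axioms.
-/

noncomputable section

open Set Filter Topology Real Finset
open Summit.Ventures.GridStability.Models.StructurePreserving
open Summit.Ventures.GridStability.Models.StructurePreserving.Params
open Literature.MathematicalPhysics.PowerSystems (SinusoidalCoupling.sectorGain_pos)

namespace Summit.Ventures.GridStability.Lyapunov.StructurePreserving

variable {n : ℕ}

/-! ### Path Cauchy–Schwarz on the coupling graph -/

/-- **Telescoping along a walk**: `φᵤ − φᵥ = Σ_{darts (a, c) of w} (φ_a − φ_c)`. [folklore] -/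
theorem sub_eq_sum_darts {G : SimpleGraph (Fin n)} (φ : Fin n → ℝ) {u v : Fin n} (w : G.Walk u v) :
    φ u - φ v = (w.darts.map fun e => φ e.fst - φ e.snd).sum := by
  induction w with
  | nil => simp
  | cons h p ih =>
    rw [SimpleGraph.Walk.darts_cons, List.map_cons, List.sum_cons, ← ih]
    show _ = (φ _ - φ _) + _
    ring

/-- **A dart sum along a walk with distinct darts is below the ordered double sum** (nonnegative
terms): `Σ_{darts (a,c) of w} F a c ≤ Σ_a Σ_c F a c`. [folklore] -/
theorem sum_darts_le_sum_sum {G : SimpleGraph (Fin n)} {u v : Fin n} (w : G.Walk u v)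
    (hw : w.darts.Nodup) (F : Fin n → Fin n → ℝ) (hF : ∀ a c, 0 ≤ F a c) :
    (w.darts.map fun e => F e.fst e.snd).sum ≤ ∑ a, ∑ c, F a c := by
  rw [← List.sum_toFinset _ hw]
  have hinj : Set.InjOn (fun e : G.Dart => e.toProd) ↑w.darts.toFinset :=
    fun a _ b _ h => SimpleGraph.Dart.ext a b h
  have himg : ∑ e ∈ w.darts.toFinset, F e.fst e.snd
      = ∑ q ∈ w.darts.toFinset.image (fun e : G.Dart => e.toProd), F q.1 q.2 := by
    rw [Finset.sum_image hinj]
  rw [himg]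
  have hsub : w.darts.toFinset.image (fun e : G.Dart => e.toProd)
      ⊆ (Finset.univ : Finset (Fin n)) ×ˢ (Finset.univ : Finset (Fin n)) :=
    fun q _ => Finset.mem_product.2 ⟨Finset.mem_univ _, Finset.mem_univ _⟩
  calc ∑ q ∈ w.darts.toFinset.image (fun e : G.Dart => e.toProd), F q.1 q.2
      ≤ ∑ q ∈ (Finset.univ : Finset (Fin n)) ×ˢ (Finset.univ : Finset (Fin n)), F q.1 q.2 :=
        Finset.sum_le_sum_of_subset_of_nonneg hsub fun q _ _ => hF q.1 q.2
    _ = ∑ a, ∑ c, F a c := Finset.sum_product' _ _ _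

/-- **Cauchy–Schwarz along a walk with distinct darts**:
`(φᵤ − φᵥ)² ≤ length(w)·Σ_{darts (a,c) of w} (φ_a − φ_c)²`. [folklore] -/
theorem sq_sub_le_length_mul_sum_darts {G : SimpleGraph (Fin n)} (φ : Fin n → ℝ) {u v : Fin n}
    (w : G.Walk u v) (hw : w.darts.Nodup) :
    (φ u - φ v) ^ 2 ≤ (w.length : ℝ) * (w.darts.map fun e => (φ e.fst - φ e.snd) ^ 2).sum := by
  rw [sub_eq_sum_darts φ w, ← List.sum_toFinset _ hw, ← List.sum_toFinset _ hw]
  have hcs := Finset.sum_mul_sq_le_sq_mul_sq w.darts.toFinset (fun _ => (1 : ℝ))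
    (fun e => φ e.fst - φ e.snd)
  simp only [one_mul, one_pow, Finset.sum_const, nsmul_eq_mul, mul_one] at hcs
  rw [List.toFinset_card_of_nodup hw, SimpleGraph.Walk.length_darts] at hcs
  exact hcs

/-- **Edge deviations along a walk of the coupling graph**: for susceptive couplings with `bᵢⱼ ≥ β > 0`
on the edges and a walk `w` with distinct darts (e.g. a path) of length `ℓ` from `u` to `v`,
`(φᵤ − φᵥ)² ≤ 4ℓ·Q/β` with `φ = δ − δ₀`, `Q = ½ΣᵢΣⱼ bᵢⱼ(Δσᵢⱼ)²/2` (path Cauchy–Schwarz; each dart is an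
edge, `(Δσ)² ≤ b(Δσ)²/β`; the darts' `bΔσ²` sum is below the ordered double sum `4Q`). [folklore] -/
theorem sq_sub_le_of_walk (p : Params n) (hb : ∀ i j, 0 ≤ p.b i j) {β : ℝ} (hβ : 0 < β)
    (hβb : ∀ i j, p.couplingGraph.Adj i j → β ≤ p.b i j) (δ₀ δ : Fin n → ℝ) {u v : Fin n}
    (w : p.couplingGraph.Walk u v) (hw : w.darts.Nodup) :
    ((δ u - δ₀ u) - (δ v - δ₀ v)) ^ 2
      ≤ 4 * (w.length : ℝ)
          * ((1 / 2) * ∑ a, ∑ c, p.b a c * (((δ a - δ c) - (δ₀ a - δ₀ c)) ^ 2 / 2)) / β := by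
  set φ : Fin n → ℝ := fun i => δ i - δ₀ i with hφ
  have hcs := sq_sub_le_length_mul_sum_darts φ w hw
  -- Σ_darts (Δφ)² ≤ (1/β) Σ_darts b (Δφ)² ≤ (1/β) ΣΣ b (Δσ − Δσ*)²
  have h1 : (w.darts.map fun e => (φ e.fst - φ e.snd) ^ 2).sum
      ≤ (w.darts.map fun e => p.b e.fst e.snd * (φ e.fst - φ e.snd) ^ 2 / β).sum := by
    rw [← List.sum_toFinset _ hw, ← List.sum_toFinset _ hw]
    refine Finset.sum_le_sum fun e _ => ?_
    have hbe : β ≤ p.b e.fst e.snd := hβb _ _ e.adj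
    rw [le_div_iff₀ hβ]
    have hsq : 0 ≤ (φ e.fst - φ e.snd) ^ 2 := sq_nonneg _
    nlinarith
  have h2 : (w.darts.map fun e => p.b e.fst e.snd * (φ e.fst - φ e.snd) ^ 2 / β).sum
      ≤ ∑ a, ∑ c, p.b a c * (φ a - φ c) ^ 2 / β :=
    sum_darts_le_sum_sum w hw (fun a c => p.b a c * (φ a - φ c) ^ 2 / β)
      fun a c => div_nonneg (mul_nonneg (hb a c) (sq_nonneg _)) hβ.le
  have h3 : ∑ a, ∑ c, p.b a c * (φ a - φ c) ^ 2 / β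
      = 4 * ((1 / 2) * ∑ a, ∑ c, p.b a c * (((δ a - δ c) - (δ₀ a - δ₀ c)) ^ 2 / 2)) / β := by
    rw [eq_div_iff hβ.ne']
    simp only [Finset.mul_sum, Finset.sum_mul]
    refine Finset.sum_congr rfl fun a _ => Finset.sum_congr rfl fun c _ => ?_
    simp only [hφ]
    field_simp
    ring
  have hlen : 0 ≤ (w.length : ℝ) := Nat.cast_nonneg _
  have hid : (δ u - δ₀ u) - (δ v - δ₀ v) = φ u - φ v := by simp only [hφ]
  rw [hid]
  calc (φ u - φ v) ^ 2 ≤ (w.length : ℝ) * (w.darts.map fun e => (φ e.fst - φ e.snd) ^ 2).sum := hcs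
    _ ≤ (w.length : ℝ) * (∑ a, ∑ c, p.b a c * (φ a - φ c) ^ 2 / β) :=
        mul_le_mul_of_nonneg_left (h1.trans h2) hlen
    _ = 4 * (w.length : ℝ)
          * ((1 / 2) * ∑ a, ∑ c, p.b a c * (((δ a - δ c) - (δ₀ a - δ₀ c)) ^ 2 / 2)) / β := by
        rw [h3]; ring

/-! ### The leaf Poincaré bound with the diameter constant -/

/-- **Leaf Poincaré bound, diameter form.** Well-formed data on `n ≠ 0` buses, susceptive couplings with
`bᵢⱼ ≥ β > 0` on the edges, and a number `d` such that every two buses are joined by a walk of the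
coupling graph of length `≤ d` (a diameter bound; preconnectedness follows). On the momentum leaf
(`constraintSet`): `Σ Dᵢφᵢ² ≤ (4d·ΣD/β)·Q + (2Σ_gen M/ΣD)·K`. Proof: `Σ Dᵢφᵢ² = Σ Dᵢ(φᵢ − φ̄)² + ΣD·φ̄²`;
`|φᵢ − φ̄| ≤ maxⱼ|φᵢ − φⱼ| ≤ √(4dQ/β)` by `sq_sub_le_of_walk` on a shortest path (`Walk.bypass`); the mean
part by Cauchy–Schwarz on `ΣD·φ̄ = −Σ_gen Mᵢωᵢ` as in the `n²` version. [folklore] -/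
theorem sum_D_sq_le_of_diam {p : Params n} (hp : p.WellFormed) (hn : n ≠ 0)
    (hb : ∀ i j, 0 ≤ p.b i j) {β : ℝ} (hβ : 0 < β)
    (hβb : ∀ i j, p.couplingGraph.Adj i j → β ≤ p.b i j) {d : ℕ}
    (hdiam : ∀ i j : Fin n, ∃ w : p.couplingGraph.Walk i j, w.length ≤ d)
    {δ₀ : Fin n → ℝ} {x : (Fin n → ℝ) × (Fin n → ℝ)} (hx : x ∈ constraintSet p δ₀) :
    ∑ i, p.D i * (x.1 i - δ₀ i) ^ 2
      ≤ 4 * (d : ℝ) * (∑ i, p.D i) / β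
          * ((1 / 2) * ∑ i, ∑ j, p.b i j * (((x.1 i - x.1 j) - (δ₀ i - δ₀ j)) ^ 2 / 2))
        + 2 * (∑ i ∈ p.gen, p.M i) / (∑ i, p.D i) * p.kinetic x.2 := by
  set φ : Fin n → ℝ := fun i => x.1 i - δ₀ i with hφ
  set SD : ℝ := ∑ i, p.D i with hSD
  set Qx : ℝ := (1 / 2) * ∑ i, ∑ j, p.b i j * (((x.1 i - x.1 j) - (δ₀ i - δ₀ j)) ^ 2 / 2)
    with hQx
  have hSDpos : 0 < SD := sum_D_pos hp hn
  have hQ0 : 0 ≤ Qx := p.quadraticGap_nonneg hb δ₀ x.1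
  have hd0 : 0 ≤ (d : ℝ) := Nat.cast_nonneg _
  -- (1) pairwise bound from a shortest path
  set R : ℝ := Real.sqrt (4 * (d : ℝ) * Qx / β) with hR
  have hRnn : 0 ≤ R := Real.sqrt_nonneg _
  have hR2 : R ^ 2 = 4 * (d : ℝ) * Qx / β := Real.sq_sqrt (by positivity)
  have hpair : ∀ i j, |φ i - φ j| ≤ R := by
    intro i j
    obtain ⟨w, hw⟩ := hdiam i j
    have hpath := w.bypass_isPath
    have hnd := SimpleGraph.Walk.darts_nodup_of_support_nodup hpath.support_nodup
    have hlen : (w.bypass.length : ℝ) ≤ d := by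
      exact_mod_cast (w.length_bypass_le_length).trans hw
    have h := sq_sub_le_of_walk p hb hβ hβb δ₀ x.1 w.bypass hnd
    refine Real.abs_le_sqrt ?_
    have hid : φ i - φ j = (x.1 i - δ₀ i) - (x.1 j - δ₀ j) := by simp only [hφ]
    rw [hid, ← hQx] at *
    calc ((x.1 i - δ₀ i) - (x.1 j - δ₀ j)) ^ 2 ≤ 4 * (w.bypass.length : ℝ) * Qx / β := h
      _ ≤ 4 * (d : ℝ) * Qx / β := by
          apply div_le_div_of_nonneg_right _ hβ.le
          nlinarith
  -- (2) the D-weighted mean `s/SD`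
  set s : ℝ := ∑ j, p.D j * φ j with hs
  have hdev : ∀ i, |φ i - s / SD| ≤ R := fun i => by
    have hmul : SD * (φ i - s / SD) = ∑ j, p.D j * (φ i - φ j) := by
      have : SD * (φ i - s / SD) = SD * φ i - s := by field_simp
      rw [this, hSD, hs, Finset.sum_mul, ← Finset.sum_sub_distrib]
      exact Finset.sum_congr rfl fun j _ => by ring
    have habs : SD * |φ i - s / SD| ≤ SD * R := by
      rw [← abs_of_pos hSDpos, ← abs_mul, abs_of_pos hSDpos, hmul]
      refine (Finset.abs_sum_le_sum_abs _ _).trans ?_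
      rw [hSD, Finset.sum_mul]
      refine Finset.sum_le_sum fun j _ => ?_
      rw [abs_mul, abs_of_pos (hp.D_pos j)]
      exact mul_le_mul_of_nonneg_left (hpair i j) (hp.D_pos j).le
    exact le_of_mul_le_mul_left habs hSDpos
  have hdev2 : ∀ i, (φ i - s / SD) ^ 2 ≤ 4 * (d : ℝ) * Qx / β := fun i => by
    have := hdev i
    have h1 : (φ i - s / SD) ^ 2 ≤ R ^ 2 :=
      sq_le_sq' (by linarith [(abs_le.1 this).1]) (abs_le.1 this).2
    rw [hR2] at h1
    exact h1
  -- (3) variance identity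
  have hvar : ∑ i, p.D i * φ i ^ 2 = ∑ i, p.D i * (φ i - s / SD) ^ 2 + s ^ 2 / SD := by
    have hexp : ∑ i, p.D i * (φ i - s / SD) ^ 2
        = ∑ i, p.D i * φ i ^ 2 - 2 * (s / SD) * ∑ i, p.D i * φ i + (s / SD) ^ 2 * ∑ i, p.D i := by
      rw [Finset.mul_sum, Finset.mul_sum, ← Finset.sum_sub_distrib, ← Finset.sum_add_distrib]
      exact Finset.sum_congr rfl fun i _ => by ring
    rw [hexp, ← hs, ← hSD]
    field_simp
    ring
  have hvarbd : ∑ i, p.D i * (φ i - s / SD) ^ 2 ≤ SD * (4 * (d : ℝ) * Qx / β) := by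
    rw [hSD, Finset.sum_mul]
    exact Finset.sum_le_sum fun i _ => mul_le_mul_of_nonneg_left (hdev2 i) (hp.D_pos i).le
  -- (4) the mean part (leaf + Cauchy–Schwarz), verbatim as in the `n²` version
  have hmom : s = -∑ j ∈ p.gen, p.M j * x.2 j := by
    have hL := hx.1
    unfold Params.momentum at hL
    simp only [Pi.zero_apply, mul_zero, Finset.sum_const_zero, zero_add] at hL
    have hsplit : ∑ j, p.D j * x.1 j - ∑ j, p.D j * δ₀ j = s := by
      rw [hs, ← Finset.sum_sub_distrib]
      exact Finset.sum_congr rfl fun j _ => by simp only [hφ]; ring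
    linarith
  have hCS : s ^ 2 ≤ (∑ j ∈ p.gen, p.M j) * (2 * p.kinetic x.2) := by
    rw [hmom, neg_sq]
    have h := Finset.sum_sq_le_sum_mul_sum_of_sq_le_mul p.gen
      (r := fun j => p.M j * x.2 j) (f := fun j => p.M j) (g := fun j => p.M j * x.2 j ^ 2)
      (fun j hj => (hp.M_pos j hj).le)
      (fun j hj => mul_nonneg (hp.M_pos j hj).le (sq_nonneg _))
      (fun j _ => by ring_nf; exact le_rfl)
    have hK : 2 * p.kinetic x.2 = ∑ j ∈ p.gen, p.M j * x.2 j ^ 2 := by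
      unfold Params.kinetic; ring
    rw [hK]
    exact h
  have hmean : s ^ 2 / SD ≤ 2 * (∑ i ∈ p.gen, p.M i) / SD * p.kinetic x.2 := by
    rw [div_le_iff₀ hSDpos]
    have : 2 * (∑ i ∈ p.gen, p.M i) / SD * p.kinetic x.2 * SD
        = (∑ j ∈ p.gen, p.M j) * (2 * p.kinetic x.2) := by
      field_simp
    rw [this]
    exact hCS
  -- (5) assemble
  have hmain : ∑ i, p.D i * φ i ^ 2
      ≤ SD * (4 * (d : ℝ) * Qx / β) + 2 * (∑ i ∈ p.gen, p.M i) / SD * p.kinetic x.2 := by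
    rw [hvar]
    exact add_le_add hvarbd hmean
  have hrew : SD * (4 * (d : ℝ) * Qx / β) = 4 * (d : ℝ) * SD / β * Qx := by
    field_simp
  rw [hrew] at hmain
  simpa only [hφ, hSD, hQx] using hmain

/-! ### The sharpened closed-form rate and gain -/

/-- **The sharpened rate** `vhRateD p β θ h d = min{ h/(1 + h·Σ_gen M/ΣD), 2h·g(θ)/(1 + 4h·d·ΣD/β) }`
(`d` = a bound on the coupling-graph distances). [folklore] -/
def vhRateD (p : Params n) (β θ h : ℝ) (d : ℕ) : ℝ :=
  min (h / (1 + h * (∑ i ∈ p.gen, p.M i) / (∑ i, p.D i)))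
    (2 * h * ((1 - Real.sin θ) / (π / 2 - θ)) / (1 + 4 * h * (d : ℝ) * (∑ i, p.D i) / β))

/-- **The sharpened gain** `vhGainD p β θ h d = max{2 + 2h·Σ_gen M/ΣD, (1 + 4h·d·ΣD/β)/g(θ)}`. [folklore] -/
def vhGainD (p : Params n) (β θ h : ℝ) (d : ℕ) : ℝ :=
  max (2 + 2 * h * (∑ i ∈ p.gen, p.M i) / (∑ i, p.D i))
    ((1 + 4 * h * (d : ℝ) * (∑ i, p.D i) / β) / ((1 - Real.sin θ) / (π / 2 - θ)))

/-- `vhRateD > 0`. [folklore] -/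
theorem vhRateD_pos {p : Params n} (hp : p.WellFormed) (hn : n ≠ 0) {β θ h : ℝ} (hβ : 0 < β)
    (hθ0 : 0 ≤ θ) (hθ : θ < π / 2) (hh : 0 < h) (d : ℕ) : 0 < vhRateD p β θ h d := by
  have hSD : 0 < ∑ i, p.D i := sum_D_pos hp hn
  have hSM : 0 ≤ ∑ i ∈ p.gen, p.M i := Finset.sum_nonneg fun i hi => (hp.M_pos i hi).le
  have hg : 0 < (1 - Real.sin θ) / (π / 2 - θ) := SinusoidalCoupling.sectorGain_pos hθ0 hθ
  have hd0 : 0 ≤ (d : ℝ) := Nat.cast_nonneg _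
  unfold vhRateD
  refine lt_min ?_ ?_
  · have : 0 < 1 + h * (∑ i ∈ p.gen, p.M i) / ∑ i, p.D i := by positivity
    positivity
  · have : 0 < 1 + 4 * h * (d : ℝ) * (∑ i, p.D i) / β := by positivity
    positivity

/-- `2 ≤ vhGainD`. [folklore] -/
theorem two_le_vhGainD {p : Params n} (hp : p.WellFormed) (hn : n ≠ 0) {β θ h : ℝ} (hh : 0 ≤ h)
    (d : ℕ) : 2 ≤ vhGainD p β θ h d := by
  have hSD : 0 < ∑ i, p.D i := sum_D_pos hp hn
  have hSM : 0 ≤ ∑ i ∈ p.gen, p.M i := Finset.sum_nonneg fun i hi => (hp.M_pos i hi).le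
  unfold vhGainD
  refine le_trans ?_ (le_max_left _ _)
  have : 0 ≤ 2 * h * (∑ i ∈ p.gen, p.M i) / ∑ i, p.D i := by positivity
  linarith

/-- **`V̇_h ≤ −vhRateD·V_h` on the closed window ∩ momentum leaf** (the pointwise inequality of
`fderiv_vh_le_neg_vhRate_mul` with the diameter constant): well-formed data on `n ≠ 0` buses, susceptive
couplings with `bᵢⱼ ≥ β > 0` on the edges, every two buses joined by a walk of length `≤ d`, equilibrium
line angles `|σ*| ≤ θ < π/2`, a synchronous equilibrium `δ₀`, `0 < h`, `2hMᵢ ≤ Dᵢ` on the generators.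
MODEL MV-3; no sentence here says a grid is stable or well damped. [cite: Khalil2002, Theorem 4.10] -/
theorem fderiv_vh_le_neg_vhRateD_mul {p : Params n} (hp : p.WellFormed) (hn : n ≠ 0)
    (hb : ∀ i j, 0 ≤ p.b i j) {β : ℝ} (hβ : 0 < β)
    (hβb : ∀ i j, p.couplingGraph.Adj i j → β ≤ p.b i j) {d : ℕ}
    (hdiam : ∀ i j : Fin n, ∃ w : p.couplingGraph.Walk i j, w.length ≤ d)
    {δ₀ : Fin n → ℝ} {θ : ℝ} (hθ0 : 0 ≤ θ) (hθ : θ < π / 2)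
    (h0 : ∀ i j, p.b i j ≠ 0 → |δ₀ i - δ₀ j| ≤ θ) (hδ₀ : p.IsSyncEquilibrium δ₀)
    {h : ℝ} (hh : 0 < h) (hhM : ∀ i ∈ p.gen, 2 * h * p.M i ≤ p.D i)
    {x : (Fin n → ℝ) × (Fin n → ℝ)} (hx : x ∈ constraintSet p δ₀)
    (hP : ∀ i j, p.b i j ≠ 0 → |x.1 i - x.1 j| ≤ π / 2) :
    fderiv ℝ (fun y => phaseEnergy p δ₀ y + h * crossTerm p δ₀ y) x (phaseField p x)
      ≤ -vhRateD p β θ h d * (phaseEnergy p δ₀ x + h * crossTerm p δ₀ x) := by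
  set gθ := (1 - Real.sin θ) / (π / 2 - θ) with hgθ
  set SD : ℝ := ∑ i, p.D i with hSD
  set SM : ℝ := ∑ i ∈ p.gen, p.M i with hSM
  set K : ℝ := p.kinetic x.2 with hK
  set Qx : ℝ := (1 / 2) * ∑ i, ∑ j, p.b i j * (((x.1 i - x.1 j) - (δ₀ i - δ₀ j)) ^ 2 / 2)
    with hQx
  set Φ : ℝ := ∑ i, p.D i * (x.1 i - δ₀ i) ^ 2 with hΦ
  set ρ := vhRateD p β θ h d with hρ
  have hSDpos : 0 < SD := sum_D_pos hp hn
  have hSM0 : 0 ≤ SM := Finset.sum_nonneg fun i hi => (hp.M_pos i hi).le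
  have hg : 0 < gθ := SinusoidalCoupling.sectorGain_pos hθ0 hθ
  have hK0 : 0 ≤ K := p.kinetic_nonneg (fun i hi => (hp.M_pos i hi).le) x.2
  have hQ0 : 0 ≤ Qx := p.quadraticGap_nonneg hb δ₀ x.1
  have hd0 : 0 ≤ (d : ℝ) := Nat.cast_nonneg _
  -- (1) dissipation: V̇_h ≤ −2hK − 2h·g·Q
  have hdiss : fderiv ℝ (fun y => phaseEnergy p δ₀ y + h * crossTerm p δ₀ y) x (phaseField p x)
      ≤ -(2 * h * K) - 2 * h * gθ * Qx := by
    rw [fderiv_vh_phaseField hp hδ₀ h x, vh_rate_eq x δ₀ h]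
    have h1 : 0 ≤ ∑ i ∈ univ \ p.gen, p.D i * (phaseField p x).1 i ^ 2 :=
      Finset.sum_nonneg fun i _ => mul_nonneg (hp.D_pos i).le (sq_nonneg _)
    have h2 : 2 * h * K ≤ ∑ i ∈ p.gen, (p.D i - h * p.M i) * x.2 i ^ 2 := by
      have hK2 : 2 * h * K = ∑ i ∈ p.gen, h * p.M i * x.2 i ^ 2 := by
        rw [hK]; unfold Params.kinetic
        rw [Finset.mul_sum, Finset.mul_sum]
        exact Finset.sum_congr rfl fun i _ => by ring
      rw [hK2]
      refine Finset.sum_le_sum fun i hi => mul_le_mul_of_nonneg_right ?_ (sq_nonneg _)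
      linarith [hhM i hi]
    have h3 : 2 * gθ * Qx ≤ pairing p δ₀ x.1 := pairing_ge_quadratic p hb hθ h0 hP
    nlinarith
  -- (2) upper bound with the diameter constant
  have hup : phaseEnergy p δ₀ x + h * crossTerm p δ₀ x
      ≤ (2 + 2 * h * SM / SD) * K + (1 + 4 * h * (d : ℝ) * SD / β) * Qx := by
    have hA := vh_le_of_two_mul_le hp hb δ₀ hh.le hhM x
    have hB := sum_D_sq_le_of_diam hp hn hb hβ hβb hdiam hx
    rw [← hK, ← hΦ, ← hQx] at hA
    rw [← hΦ, ← hQx, ← hSD, ← hSM] at hB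
    have hB' := mul_le_mul_of_nonneg_left hB hh.le
    have : h * (4 * (d : ℝ) * SD / β * Qx + 2 * SM / SD * K)
        = (2 * h * SM / SD) * K + (4 * h * (d : ℝ) * SD / β) * Qx := by ring
    rw [this] at hB'
    linarith
  -- (3) the rate constants
  have hρ1 : ρ * (2 + 2 * h * SM / SD) ≤ 2 * h := by
    have hden : 0 < 1 + h * SM / SD := by positivity
    have hle : ρ ≤ h / (1 + h * SM / SD) := by
      rw [hρ]; unfold vhRateD; rw [← hSD, ← hSM]; exact min_le_left _ _
    have := mul_le_mul_of_nonneg_right hle (show 0 ≤ 2 + 2 * h * SM / SD by positivity)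
    have heq : h / (1 + h * SM / SD) * (2 + 2 * h * SM / SD) = 2 * h := by
      have e : 2 + 2 * h * SM / SD = 2 * (1 + h * SM / SD) := by ring
      rw [e]
      field_simp
    linarith
  have hρ2 : ρ * (1 + 4 * h * (d : ℝ) * SD / β) ≤ 2 * h * gθ := by
    have hden : 0 < 1 + 4 * h * (d : ℝ) * SD / β := by positivity
    have hle : ρ ≤ 2 * h * gθ / (1 + 4 * h * (d : ℝ) * SD / β) := by
      rw [hρ]; unfold vhRateD; rw [← hSD, ← hgθ]; exact min_le_right _ _
    have := mul_le_mul_of_nonneg_right hle hden.le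
    have heq : 2 * h * gθ / (1 + 4 * h * (d : ℝ) * SD / β)
        * (1 + 4 * h * (d : ℝ) * SD / β) = 2 * h * gθ := by
      field_simp
    linarith
  -- (4) combine
  have hρ0 : 0 ≤ ρ := (vhRateD_pos hp hn hβ hθ0 hθ hh d).le
  have hfin : ρ * (phaseEnergy p δ₀ x + h * crossTerm p δ₀ x) ≤ 2 * h * K + 2 * h * gθ * Qx := by
    have := mul_le_mul_of_nonneg_left hup hρ0
    have e : ρ * ((2 + 2 * h * SM / SD) * K + (1 + 4 * h * (d : ℝ) * SD / β) * Qx)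
        = (ρ * (2 + 2 * h * SM / SD)) * K + (ρ * (1 + 4 * h * (d : ℝ) * SD / β)) * Qx := by
      ring
    rw [e] at this
    nlinarith [mul_le_mul_of_nonneg_right hρ1 hK0, mul_le_mul_of_nonneg_right hρ2 hQ0]
  linarith

end Summit.Ventures.GridStability.Lyapunov.StructurePreserving

end
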